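import Summits.HodgeConjecture.HodgeCM.PerL34.QuotientSmoothing_1

/-! PORT of `HodgeCM/PerL34/QuotientSmoothing.lean` (HodgeCMPerL run 82) — part 2: continuation of `Summits.HodgeConjecture.HodgeCM.PerL34.QuotientSmoothing_1` (split at a top-level declaration boundary by port_pkg.py; scope re-opened below; declarations unchanged). -/

-- port_pkg: scope re-opened for this part (file-level context, then the namespace/section stack open at the cut)
set_option autoImplicit false
noncomputable section
open MeasureTheory Topology Filter Function
open scoped ENNReal Pointwise
attribute [-instance] Quotient.instMeasurableSpace
namespace HodgeCM
namespace PerL34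
namespace QuotientSmoothing
section Regular
variable {G : Type*} [Group G] [TopologicalSpace G] [IsTopologicalGroup G] {Γ : Subgroup G}
variable [MeasurableSpace (G ⧸ Γ)] [BorelSpace (G ⧸ Γ)] (ν : Measure (G ⧸ Γ)) [SMulInvariantMeasure G (G ⧸ Γ) ν]
variable [T2Space (G ⧸ Γ)] [IsFiniteMeasure ν] [ν.InnerRegularCompactLTTop]
variable [CompactSpace (G ⧸ Γ)]
variable [MeasurableSpace G] [BorelSpace G] (μ : Measure G) [IsFiniteMeasureOnCompacts μ]
  (f : G → ℝ) (hf : Continuous f) (hfs : HasCompactSupport f)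
omit [MeasurableSpace (G ⧸ Γ)] [BorelSpace (G ⧸ Γ)] [T2Space (G ⧸ Γ)] in
include hf hfs in
/-- (Ported verbatim from the HodgeCMPerL package; no docstring in the source.) -/
theorem integral_smul_comp_act_apply (y : C(G ⧸ Γ, ℂ)) (p : G ⧸ Γ) :
    (∫ g, (f g : ℂ) • y.comp (act (Γ := Γ) g) ∂μ) p = ∫ g, (f g : ℂ) * y (g⁻¹ • p) ∂μ := by
  rw [ContinuousMap.integral_apply (integrable_smul_comp_act μ f hf hfs y)]
  rfl

variable [LocallyCompactSpace G] [DiscreteTopology Γ] [Countable Γ] (hΓ : IsClosed (Γ : Set G))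
  [μ.IsMulLeftInvariant] [μ.IsMulRightInvariant] [μ.IsInvInvariant]
  {𝓕 : Set G} (h𝓕 : IsFundamentalDomain Γ.op 𝓕 μ)
  (hν : ν = Measure.map (QuotientGroup.mk : G → G ⧸ Γ) (μ.restrict 𝓕))

include h𝓕 hν in
/-- `R(f)` and the kernel operator `𝒯_{K_f}` agree on `toLp (C(X, ℂ))`. -/
theorem smOpX_toLp_eq_opT (y : C(G ⧸ Γ, ℂ)) :
    smOpX ν μ f hf hfs (ContinuousMap.toLp (E := ℂ) 2 ν ℂ y) =
      KernelOperator.opT (foldK hΓ f hf hfs) ν ν (ContinuousMap.toLp (E := ℂ) 2 ν ℂ y) := by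
  rw [smOpX_toLp, KernelOperator.opT_eq_toLp]
  congr 1
  ext p
  rw [integral_smul_comp_act_apply μ f hf hfs y p, KernelOperator.evalTC_apply, KernelOperator.evalT_eq_integral]
  have hR : ∫ q, foldK hΓ f hf hfs (p, q) * (ContinuousMap.toLp (E := ℂ) 2 ν ℂ y : G ⧸ Γ → ℂ) q ∂ν =
      ∫ q, foldK hΓ f hf hfs (p, q) * y q ∂ν :=
    integral_congr_ae (by
      filter_upwards [ContinuousMap.coeFn_toLp (E := ℂ) (p := 2) (𝕜 := ℂ) ν y] with q hq
      rw [hq])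
  rw [hR]
  induction p using QuotientGroup.induction_on with
  | H a =>
    rw [hν]
    exact integral_mul_act_eq hΓ μ f hf hfs h𝓕 y a

include h𝓕 hν in
/-- **`R(f) = 𝒯_{K_f}` on `L²(X)`** (tex ll. 378–382). -/
theorem smOpX_eq_opT : smOpX ν μ f hf hfs = KernelOperator.opT (foldK hΓ f hf hfs) ν ν := by
  have hd := ContinuousMap.toLp_denseRange ℂ ν ℂ (ENNReal.ofNat_ne_top (n := 2))
  have heq := hd.equalizer (smOpX ν μ f hf hfs).continuous
    (KernelOperator.opT (foldK hΓ f hf hfs) ν ν).continuous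
    (funext fun y => smOpX_toLp_eq_opT ν μ f hf hfs hΓ h𝓕 hν y)
  exact ContinuousLinearMap.ext fun v => congrFun heq v

include hΓ h𝓕 hν in
/-- **`[SETUP D7] sm_cont` over the model:** every `R(f) v`, `v ∈ L²(X)`, is (the class of) a continuous
function, namely `𝒯_{K_f} v ∈ C(X, ℂ)`. -/
theorem exists_toLp_eq_smOpX (v : Lp ℂ 2 ν) :
    ∃ x : C(G ⧸ Γ, ℂ), ContinuousMap.toLp (E := ℂ) 2 ν ℂ x = smOpX ν μ f hf hfs v :=
  ⟨KernelOperator.evalTC (foldK hΓ f hf hfs) ν v, by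
    rw [smOpX_eq_opT ν μ f hf hfs hΓ h𝓕 hν, KernelOperator.opT_eq_toLp]⟩

include hΓ h𝓕 hν in
/-- The literal shape of the field `AnnihilationDatum.sm_cont` (`∀ n v, ∃ x : Cf, j x = sm n v`) for a sequence
of test functions `f n ∈ C_c(G)`, `sm n = R(f n)`, `Cf = C(X, ℂ)`, `j = toLp`. -/
theorem sm_cont_model (fs : ℕ → G → ℝ) (hc : ∀ n, Continuous (fs n)) (hs : ∀ n, HasCompactSupport (fs n)) :
    ∀ (n : ℕ) (v : Lp ℂ 2 ν), ∃ x : C(G ⧸ Γ, ℂ),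
      ContinuousMap.toLp (E := ℂ) 2 ν ℂ x = smOpX ν μ (fs n) (hc n) (hs n) v :=
  fun n v => exists_toLp_eq_smOpX ν μ (fs n) (hc n) (hs n) hΓ h𝓕 hν v

end Regular

end QuotientSmoothing
end PerL34
end HodgeCM

end
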